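import Mathlib
import HarnessLib
import Summits.CriticalPhenomena.PercolationContinuityZ3.Theses.PercDustRigidity
import Literature.Probability.Percolation.UniquenessInsertionTolerant

/-!
# `DustRigidity` — BC2 redirect: split assembly (crux-strategist, 2026-08-17)

Route `PercDustRigidity`, deciding crux `DustRigidity` (item `stmt-CriticalPhenomena-9591`).

`DustRigidity` (X): every probability measure `μ` on bond configurations of `ℤ³` with the ten
hypotheses (H1)–(H9) of FKG half-space rigidity (lattice support, shift invariance, ergodicity,
insertion tolerance, deletion tolerance, ergodicity under every non-zero shift, automorphism
invariance, positive association, a.s. finite coordinate half-space clusters) which is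
DUST-FRAGILE (some density-zero `S ⊆ D₁` kills every infinite cluster: a.s. all clusters of
`ω \ S` are finite) does not percolate.

Write `D_k = {s(y, y + e₃) : 2^k ∣ y_i ∀ i}` (the level-`k` plug sieve of the route; `D₁ ⊇ D₂ ⊇ …`,
`⋂ D_k = {s(0, e₃)}`) and `Death_μ(T) :⇔ μ-a.s. every cluster of ω \ T is finite`
(monotone in `T`).  The dust clause implies `Death_μ(D₁)` (monotonicity, `S ⊆ D₁`).

The split is along the waypoint `∀ k ≥ 1, Death_μ(D_k)` ("the giant is killed by arbitrarily
sparse periodic sieves" — exactly what Aizenman–Grimmett strictness `p_c(ℤ³) < p_c(ℤ³ \ D_k)`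
gives `P_{p_c}` at every level `k`, cf. the route item `PlugSieveStrictDiminishment`):

* `NoInfinitelyFragileGiant` (X₁): (H1)–(H9) + a.s. uniqueness of the infinite cluster +
  `∀ k ≥ 1, Death_μ(D_k)` ⟹ `μ(0 ↔ ∞) = 0`;
* `SieveCoarsening` (X₂): (H1)–(H9) + a.s. uniqueness + `Death_μ(D_k)` ⟹ `Death_μ(D_{k+1})`
  (`k ≥ 1`): fragility under the level-`k` sieve propagates to the 8× sparser level-`k+1` sieve.

**Assembly** (`dustRigidity_of_subs : X₁ → X₂ → DustRigidity`): Burton–Keane uniqueness for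
insertion-tolerant ergodic measures (in tree:
`ae_numInfiniteClusters_le_one_of_isInsertionTolerantErgodic`, fed by (H1)–(H4)) discharges the
uniqueness hypothesis of both pieces; the dust clause gives `Death_μ(D₁)` by cluster
monotonicity (`openCluster_mono`, `S ⊆ D₁ = D_1` after `2 ^ 1 = 2`); induction on the level
(`Nat.le_induction`) with X₂ gives `Death_μ(D_k)` for every `k ≥ 1`; X₁ concludes.
-/

namespace Summit.CriticalPhenomena.PercolationContinuityZ3.Cruxes.DustRigidity.Split

open scoped BigOperators Topology Classical MeasureTheory ProbabilityTheory
open Filter Set Function TopologicalSpace MeasureTheory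

/-- **X₁ — no infinitely fragile giant.** For every probability measure `μ` on bond configurations
of `ℤ³` with (H1)–(H9), a.s. at most one infinite cluster, and `Death_μ(D_k)` for every `k ≥ 1`
(every level-`k` plug sieve kills all infinite clusters), `μ(|C(0)| = ∞) = 0`. -/
def NoInfinitelyFragileGiant : Prop :=
  ∀ μ : MeasureTheory.Measure (Literature.Probability.Percolation.BondConfig (Literature.Probability.LatticeModels.Site 3)), MeasureTheory.IsProbabilityMeasure μ → (∀ᵐ ω ∂μ, ω ⊆ (Literature.Probability.LatticeModels.zdGraph 3).edgeSet) → (∀ (v : Literature.Probability.LatticeModels.Site 3) (S : Set (Literature.Probability.Percolation.BondConfig (Literature.Probability.LatticeModels.Site 3))), MeasurableSet S → μ (Literature.Probability.Percolation.BondConfig.relabel (Literature.Probability.Percolation.sym2Equiv (Literature.Probability.LatticeModels.Site.shift v)) ⁻¹' S) = μ S) → (∀ S : Set (Literature.Probability.Percolation.BondConfig (Literature.Probability.LatticeModels.Site 3)), MeasurableSet S → (∀ v : Literature.Probability.LatticeModels.Site 3, Literature.Probability.Percolation.BondConfig.relabel (Literature.Probability.Percolation.sym2Equiv (Literature.Probability.LatticeModels.Site.shift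 v)) ⁻¹' S = S) → μ S = 0 ∨ μ S = 1) → (∀ N : ℕ, ∃ c : ℝ, 0 < c ∧ ∀ S : Set (Literature.Probability.Percolation.BondConfig (Literature.Probability.LatticeModels.Site 3)), MeasurableSet S → c * μ.real ((fun ω : Literature.Probability.Percolation.BondConfig (Literature.Probability.LatticeModels.Site 3) => ω ∪ ↑(Literature.Probability.LatticeModels.edgesIn (Literature.Probability.LatticeModels.zdGraph 3) (Literature.Probability.LatticeModels.box 3 N))) ⁻¹' S) ≤ μ.real S) → (∀ N : ℕ, ∃ c : ℝ, 0 < c ∧ ∀ S : Set (Literature.Probability.Percolation.BondConfig (Literature.Probability.LatticeModels.Site 3)), MeasurableSet S → c * μ.real ((fun ω : Literature.Probability.Percolation.BondConfig (Literature.Probability.LatticeModels.Site 3) => ω \ ↑(Literature.Probability.LatticeModels.edgesIn (Literature.Probability.LatticeModels.zdGraph 3) (Literature.Probability.LatticeModels.box 3 N))) ⁻¹' S) ≤ μ.real S) → (∀ v : Literature.Probability.LatticeModels.Site 3, v ≠ 0 → Ergodic (Literature.Probability.Percolation.BondConfig.relabel (Literature.Probability.Percolation.sym2Equiv (Literature.Probability.LatticeModels.Site.shift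 v))) μ) → (∀ (γ : Literature.Probability.LatticeModels.zdGraph 3 ≃g Literature.Probability.LatticeModels.zdGraph 3) (A : Set (Literature.Probability.Percolation.BondConfig (Literature.Probability.LatticeModels.Site 3))), MeasurableSet A → μ (Literature.Probability.Percolation.BondConfig.relabel (Literature.Probability.Percolation.sym2Equiv γ.toEquiv) ⁻¹' A) = μ A) → (∀ A B : Set (Literature.Probability.Percolation.BondConfig (Literature.Probability.LatticeModels.Site 3)), IsUpperSet A → IsUpperSet B → MeasurableSet A → MeasurableSet B → μ A * μ B ≤ μ (A ∩ B)) → (∀ᵐ ω ∂μ, ∀ (i : Fin 3) (a : ℤ) (v : Literature.Probability.LatticeModels.Site 3), {y : Literature.Probability.LatticeModels.Site 3 | ω ∈ Literature.Probability.Percolation.openConnIn {x : Literature.Probability.LatticeModels.Site 3 | a ≤ x i} v y}.Finite ∧ {y : Literature.Probability.LatticeModels.Site 3 | ω ∈ Literature.Probability.Percolation.openConnIn {x : Literature.Probability.LatticeModels.Site 3 | x i ≤ a} v y}.Finite) → (∀ᵐ ω ∂μ, Literature.Probability.Percolation.numInfiniteClusters ω ≤ 1) → (∀ k : ℕ, 1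 ≤ k → ∀ᵐ ω ∂μ, ∀ x : Literature.Probability.LatticeModels.Site 3, (Literature.Probability.Percolation.openCluster (ω \ {e | ∃ y : Literature.Probability.LatticeModels.Site 3, (∀ i, (2 ^ k : ℤ) ∣ y i) ∧ e = s(y, y + Pi.single (2 : Fin 3) 1)}) x).Finite) → μ (Literature.Probability.Percolation.percolatesAt (0 : Literature.Probability.LatticeModels.Site 3)) = 0

/-- **X₂ — sieve coarsening.** For every probability measure `μ` on bond configurations of `ℤ³`
with (H1)–(H9) and a.s. at most one infinite cluster, and every `k ≥ 1`: if the level-`k` plug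
sieve kills every infinite cluster (`Death_μ(D_k)`) then so does the level-`k+1` sieve
(`Death_μ(D_{k+1})`, `D_{k+1} ⊆ D_k` eight times sparser). -/
def SieveCoarsening : Prop :=
  ∀ μ : MeasureTheory.Measure (Literature.Probability.Percolation.BondConfig (Literature.Probability.LatticeModels.Site 3)), MeasureTheory.IsProbabilityMeasure μ → (∀ᵐ ω ∂μ, ω ⊆ (Literature.Probability.LatticeModels.zdGraph 3).edgeSet) → (∀ (v : Literature.Probability.LatticeModels.Site 3) (S : Set (Literature.Probability.Percolation.BondConfig (Literature.Probability.LatticeModels.Site 3))), MeasurableSet S → μ (Literature.Probability.Percolation.BondConfig.relabel (Literature.Probability.Percolation.sym2Equiv (Literature.Probability.LatticeModels.Site.shift v)) ⁻¹' S) = μ S) → (∀ S : Set (Literature.Probability.Percolation.BondConfig (Literature.Probability.LatticeModels.Site 3)), MeasurableSet S → (∀ v : Literature.Probability.LatticeModels.Site 3, Literature.Probability.Percolation.BondConfig.relabel (Literature.Probability.Percolation.sym2Equiv (Literature.Probability.LatticeModels.Site.shift v)) ⁻¹' S = S) → μ S = 0 ∨ μ S = 1) → (∀ N : ℕ, ∃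 c : ℝ, 0 < c ∧ ∀ S : Set (Literature.Probability.Percolation.BondConfig (Literature.Probability.LatticeModels.Site 3)), MeasurableSet S → c * μ.real ((fun ω : Literature.Probability.Percolation.BondConfig (Literature.Probability.LatticeModels.Site 3) => ω ∪ ↑(Literature.Probability.LatticeModels.edgesIn (Literature.Probability.LatticeModels.zdGraph 3) (Literature.Probability.LatticeModels.box 3 N))) ⁻¹' S) ≤ μ.real S) → (∀ N : ℕ, ∃ c : ℝ, 0 < c ∧ ∀ S : Set (Literature.Probability.Percolation.BondConfig (Literature.Probability.LatticeModels.Site 3)), MeasurableSet S → c * μ.real ((fun ω : Literature.Probability.Percolation.BondConfig (Literature.Probability.LatticeModels.Site 3) => ω \ ↑(Literature.Probability.LatticeModels.edgesIn (Literature.Probability.LatticeModels.zdGraph 3) (Literature.Probability.LatticeModels.box 3 N))) ⁻¹' S) ≤ μ.real S) → (∀ v : Literature.Probability.LatticeModels.Site 3, v ≠ 0 → Ergodic (Literature.Probability.Percolation.BondConfig.relabel (Literature.Probability.Percolation.sym2Equiv (Literature.Probability.LatticeModels.Site.shift v))) μ) → (∀ (γ : Literature.Probability.LatticeModels.zdGraph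 3 ≃g Literature.Probability.LatticeModels.zdGraph 3) (A : Set (Literature.Probability.Percolation.BondConfig (Literature.Probability.LatticeModels.Site 3))), MeasurableSet A → μ (Literature.Probability.Percolation.BondConfig.relabel (Literature.Probability.Percolation.sym2Equiv γ.toEquiv) ⁻¹' A) = μ A) → (∀ A B : Set (Literature.Probability.Percolation.BondConfig (Literature.Probability.LatticeModels.Site 3)), IsUpperSet A → IsUpperSet B → MeasurableSet A → MeasurableSet B → μ A * μ B ≤ μ (A ∩ B)) → (∀ᵐ ω ∂μ, ∀ (i : Fin 3) (a : ℤ) (v : Literature.Probability.LatticeModels.Site 3), {y : Literature.Probability.LatticeModels.Site 3 | ω ∈ Literature.Probability.Percolation.openConnIn {x : Literature.Probability.LatticeModels.Site 3 | a ≤ x i} v y}.Finite ∧ {y : Literature.Probability.LatticeModels.Site 3 | ω ∈ Literature.Probability.Percolation.openConnIn {x : Literature.Probability.LatticeModels.Site 3 | x i ≤ a} v y}.Finite) → (∀ᵐ ω ∂μ, Literature.Probability.Percolation.numInfiniteClusters ω ≤ 1) → ∀ k : ℕ, 1 ≤ k → (∀ᵐ ω ∂μ, ∀ x : Literature.Probability.LatticeModels.Site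 3, (Literature.Probability.Percolation.openCluster (ω \ {e | ∃ y : Literature.Probability.LatticeModels.Site 3, (∀ i, (2 ^ k : ℤ) ∣ y i) ∧ e = s(y, y + Pi.single (2 : Fin 3) 1)}) x).Finite) → ∀ᵐ ω ∂μ, ∀ x : Literature.Probability.LatticeModels.Site 3, (Literature.Probability.Percolation.openCluster (ω \ {e | ∃ y : Literature.Probability.LatticeModels.Site 3, (∀ i, (2 ^ (k + 1) : ℤ) ∣ y i) ∧ e = s(y, y + Pi.single (2 : Fin 3) 1)}) x).Finite

/-- **Assembly of the split**: `NoInfinitelyFragileGiant → SieveCoarsening → DustRigidity`. -/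
theorem dustRigidity_of_subs (hN : NoInfinitelyFragileGiant) (hC : SieveCoarsening) :
    Summit.CriticalPhenomena.PercolationContinuityZ3.Theses.PercDustRigidity.DustRigidity := by
  intro μ hμ h1 h2 h3 h4 h5 h6 h7 h8 h9 hdust
  obtain ⟨S, hS, -, hdeath⟩ := hdust
  -- (1) Burton–Keane: (H1)–(H4) are the hypotheses `IsInsertionTolerantErgodic μ`
  have hITE : Literature.Probability.Percolation.IsInsertionTolerantErgodic μ :=
    { ae_subset_edgeSet := h1
      measure_preimage_shift := fun v _ hS' => h2 v _ hS'
      zero_one := fun hS' hinv => h3 _ hS' hinv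
      insertion_tolerant := fun N => by
        obtain ⟨c, hc, hcS⟩ := h4 N
        exact ⟨c, hc, fun hS' => hcS _ hS'⟩ }
  have hU : ∀ᵐ ω ∂μ, Literature.Probability.Percolation.numInfiniteClusters ω ≤ 1 :=
    Literature.Probability.Percolation.ae_numInfiniteClusters_le_one_of_isInsertionTolerantErgodic hITE
  -- (2) dust-fragility ⇒ death off the whole level-1 sieve (cluster monotonicity, `S ⊆ D₁ = D_1`)
  have hSD : S ⊆ {e | ∃ y : Literature.Probability.LatticeModels.Site 3,
      (∀ i, (2 ^ 1 : ℤ) ∣ y i) ∧ e = s(y, y + Pi.single (2 : Fin 3) 1)} := by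
    intro e he
    obtain ⟨y, hy, rfl⟩ := hS he
    exact ⟨y, fun i => by simpa using hy i, rfl⟩
  have hD1 : ∀ᵐ ω ∂μ, ∀ x : Literature.Probability.LatticeModels.Site 3,
      (Literature.Probability.Percolation.openCluster (ω \ {e | ∃ y : Literature.Probability.LatticeModels.Site 3,
        (∀ i, (2 ^ 1 : ℤ) ∣ y i) ∧ e = s(y, y + Pi.single (2 : Fin 3) 1)}) x).Finite := by
    filter_upwards [hdeath] with ω hω x
    exact (hω x).subset (Literature.Probability.Percolation.openCluster_mono (sdiff_le_sdiff_left hSD) x)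
  -- (3) induction on the level with X₂
  have hall : ∀ k : ℕ, 1 ≤ k → ∀ᵐ ω ∂μ, ∀ x : Literature.Probability.LatticeModels.Site 3,
      (Literature.Probability.Percolation.openCluster (ω \ {e | ∃ y : Literature.Probability.LatticeModels.Site 3,
        (∀ i, (2 ^ k : ℤ) ∣ y i) ∧ e = s(y, y + Pi.single (2 : Fin 3) 1)}) x).Finite := by
    intro k hk
    induction k, hk using Nat.le_induction with
    | base => exact hD1
    | succ k hk ih => exact hC μ hμ h1 h2 h3 h4 h5 h6 h7 h8 h9 hU k hk ih
  -- (4) X₁ concludes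
  exact hN μ hμ h1 h2 h3 h4 h5 h6 h7 h8 h9 hU hall

end Summit.CriticalPhenomena.PercolationContinuityZ3.Cruxes.DustRigidity.Split
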